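/-
Width seat `ym-line-cbag-p1-w3` (prover-ym-line-cbag-p1-w3-g2-0), route `ColdBoxAllGroups`, crux `BulkAllGroups`
(stmt-QuantumFields-22255), line `dlr-chessboard-G` (lead `ym-line-cbag-p2`, PLAN v6 work package «w3 — UnitsInterfaceG»).
-/
import Summits.QuantumFields.YangMills.Theorems.ColdBoxAllGroupsBulkAllGroupsUnitsShiftG
import Summits.QuantumFields.YangMills.Theorems.ColdBoxAllGroupsBulkAllGroupsDatumPackageDatVecG

/-!
# Crux `BulkAllGroups` (stmt-QuantumFields-22255), stubs N2-mean-G / N2-cov-G: the INTERFACE UNITS — the cores' constant terms for the chart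
# datum `ϑ` ARE the registered interfaces' terms for `ϑI = (√2)⁻¹•ϑ` (PLAN v6 §w3, verbatim shapes U1–U3)

The lead's cores at fixed `β` (`abs_kernelMeanG_sub_gaussian_le_datum`, `abs_kernelCovG_sub_gaussian_le_datum`, PLAN v6) produce the constant terms
`½Σ_c F'_c(q)²` and `(Σ_c F'_c(p)F'_c(q))·C` with the SCALED background `F'_c(p) = sCirc (glue (sdatE β ϑ c) (mean (sdatE β ϑ c))) p`
(`sdatE β ϑ = √β•ϑ`, `ϑ` = the exponential coordinates of the datum, colour-major: `W e = expChart ρ (datVec ϑ e)`, `exists_datum_packageG_datVec`);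
the REGISTERED interfaces `KernelMeanExpansionG` / `KernelCovExpansionG` (`Theorems/ColdBoxAllGroupsDefs.lean`) ask for `β·Σ_c F̄_c(q)²` and
`2β·(Σ_c F̄_c(p)F̄_c(q))·C` with the UNSCALED background `F̄_c = sCirc (glue (ϑ c) (mean (ϑ c)))` of the datum they quantify over.  With
`ϑI c := (√2)⁻¹ • ϑ c` (and competitor `sI c := (√2)⁻¹ • s c`):
* (U1) `half_sum_sq_dirBackground_sdatE_eq` — `½Σ_c F'_c(q)² = β·Σ_c F̄I_c(q)²`;
* (U2) `sum_dirBackground_sdatE_mul_eq` — `Σ_c F'_c(p)F'_c(q) = 2β·Σ_c F̄I_c(p)F̄I_c(q)`;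
* (U3) `sum_formM_interface_eq` — `Σ_c M_{ϑI_c}(sI_c) = ½Σ_c M_{ϑ_c}(s_c)` (so the package's energy clause `≤ CE(2H+3)⁴β^{2δ−1}` transfers with the same `CE`);
* (U0) `datVec_eq_sqrt_two_smul_datVec_interface`, `norm_datVec_interface_le`, `interface_forest_zero` — `datVec ϑ e = √2 • datVec ϑI e`,
  `‖datVec ϑI e‖ ≤ ‖datVec ϑ e‖`, and `ϑI` vanishes where `ϑ` does (forest zeros transfer).
All `β ≥ 0`.  No new definition; standard axioms.  NOT a claim about the mass gap; the Yang–Mills mass gap is NOT proved by any of this.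
-/

set_option autoImplicit false

noncomputable section

open Finset
open Literature.Probability.LatticeModels Literature.MathematicalPhysics.QuantumLattice
open Literature.MathematicalPhysics.QuantumFieldTheory Literature.MathematicalPhysics.QuantumFieldTheory.LatticeMaxwell
open Summit.QuantumFields.YangMills.Theorems.WeakCouplingRates

namespace Summit.QuantumFields.YangMills.Theorems.ColdBoxAllGroups

variable {H : ℕ}

/-- `(√2)⁻¹ = 1/√2` and `((√2)⁻¹)² = ½`. -/
theorem sqrt_two_inv_sq : ((Real.sqrt 2)⁻¹) ^ 2 = (1 / 2 : ℝ) := by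
  rw [inv_pow, Real.sq_sqrt (by norm_num : (0 : ℝ) ≤ 2), one_div]

/-- **(U1)** `½Σ_c F'_c(q)² = β·Σ_c F̄I_c(q)²`, `F'` the background of the scaled datum `sdatE β ϑ`, `F̄I` that of `ϑI = (√2)⁻¹•ϑ` (`β ≥ 0`). -/
theorem half_sum_sq_dirBackground_sdatE_eq {D : ℕ} {β : ℝ} (hβ : 0 ≤ β)
    (ϑ : Fin D → Literature.MathematicalPhysics.QuantumLattice.ZdEdge 4 → ℝ) (q : Plaq 4) :
    1 / 2 * (∑ c, (sCirc (glue (pin := fun e => e ∉ dirFreeEdges H) dirCorner (2 * H + 3) (sdatE β ϑ c)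
        (mean (fun e => e ∉ dirFreeEdges H) dirCorner (2 * H + 3) (sdatE β ϑ c))) q) ^ 2) =
      β * (∑ c, (sCirc (glue (pin := fun e => e ∉ dirFreeEdges H) dirCorner (2 * H + 3) ((Real.sqrt 2)⁻¹ • ϑ c)
        (mean (fun e => e ∉ dirFreeEdges H) dirCorner (2 * H + 3) ((Real.sqrt 2)⁻¹ • ϑ c))) q) ^ 2) := by
  have hβ2 : Real.sqrt β ^ 2 = β := Real.sq_sqrt hβ
  simp_rw [dirBackground_sdatE_eq, sCirc_glue_smul_mean ((Real.sqrt 2)⁻¹), mul_pow, hβ2, sqrt_two_inv_sq]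
  rw [← Finset.mul_sum, ← Finset.mul_sum]; ring

/-- **(U2)** `Σ_c F'_c(p)F'_c(q) = 2β·Σ_c F̄I_c(p)F̄I_c(q)` (`β ≥ 0`). -/
theorem sum_dirBackground_sdatE_mul_eq {D : ℕ} {β : ℝ} (hβ : 0 ≤ β)
    (ϑ : Fin D → Literature.MathematicalPhysics.QuantumLattice.ZdEdge 4 → ℝ) (p q : Plaq 4) :
    (∑ c, sCirc (glue (pin := fun e => e ∉ dirFreeEdges H) dirCorner (2 * H + 3) (sdatE β ϑ c)
        (mean (fun e => e ∉ dirFreeEdges H) dirCorner (2 * H + 3) (sdatE β ϑ c))) p *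
      sCirc (glue (pin := fun e => e ∉ dirFreeEdges H) dirCorner (2 * H + 3) (sdatE β ϑ c)
        (mean (fun e => e ∉ dirFreeEdges H) dirCorner (2 * H + 3) (sdatE β ϑ c))) q) =
      2 * β * (∑ c, sCirc (glue (pin := fun e => e ∉ dirFreeEdges H) dirCorner (2 * H + 3) ((Real.sqrt 2)⁻¹ • ϑ c)
        (mean (fun e => e ∉ dirFreeEdges H) dirCorner (2 * H + 3) ((Real.sqrt 2)⁻¹ • ϑ c))) p *
      sCirc (glue (pin := fun e => e ∉ dirFreeEdges H) dirCorner (2 * H + 3) ((Real.sqrt 2)⁻¹ • ϑ c)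
        (mean (fun e => e ∉ dirFreeEdges H) dirCorner (2 * H + 3) ((Real.sqrt 2)⁻¹ • ϑ c))) q) := by
  have hββ : Real.sqrt β * Real.sqrt β = β := Real.mul_self_sqrt hβ
  have h22 : (Real.sqrt 2)⁻¹ * (Real.sqrt 2)⁻¹ = (1 / 2 : ℝ) := by
    rw [← pow_two, sqrt_two_inv_sq]
  simp_rw [dirBackground_sdatE_eq, sCirc_glue_smul_mean ((Real.sqrt 2)⁻¹)]
  rw [Finset.mul_sum]
  refine Finset.sum_congr rfl fun c _ => ?_
  set a := sCirc (glue (pin := fun e => e ∉ dirFreeEdges H) dirCorner (2 * H + 3) (ϑ c)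
    (mean (fun e => e ∉ dirFreeEdges H) dirCorner (2 * H + 3) (ϑ c))) p
  set b := sCirc (glue (pin := fun e => e ∉ dirFreeEdges H) dirCorner (2 * H + 3) (ϑ c)
    (mean (fun e => e ∉ dirFreeEdges H) dirCorner (2 * H + 3) (ϑ c))) q
  calc Real.sqrt β * a * (Real.sqrt β * b) = (Real.sqrt β * Real.sqrt β) * (a * b) := by ring
    _ = β * (a * b) := by rw [hββ]
    _ = 2 * β * ((Real.sqrt 2)⁻¹ * (Real.sqrt 2)⁻¹) * (a * b) := by rw [h22]; ring
    _ = 2 * β * ((Real.sqrt 2)⁻¹ * a * ((Real.sqrt 2)⁻¹ * b)) := by ring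

/-- **(U3)** the energy clause of the interface datum: `Σ_c M_{ϑI_c}(sI_c) = ½·Σ_c M_{ϑ_c}(s_c)`, `ϑI = (√2)⁻¹•ϑ`, `sI = (√2)⁻¹•s`. -/
theorem sum_formM_interface_eq {D : ℕ} (ϑ : Fin D → Literature.MathematicalPhysics.QuantumLattice.ZdEdge 4 → ℝ) (s : Fin D → DirFree H → ℝ) :
    ∑ c, formM (fun e => e ∉ dirFreeEdges H) dirCorner (2 * H + 3) ((Real.sqrt 2)⁻¹ • ϑ c) ((Real.sqrt 2)⁻¹ • s c) =
      1 / 2 * ∑ c, formM (fun e => e ∉ dirFreeEdges H) dirCorner (2 * H + 3) (ϑ c) (s c) := by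
  rw [← sqrt_two_inv_sq]
  exact sum_formM_smul_chartCoords ((Real.sqrt 2)⁻¹) ϑ s

/-- The energy clause TRANSFERS to the interface datum with the same constant: `Σ_c M_{ϑI_c}(sI_c) ≤ B` whenever `Σ_c M_{ϑ_c}(s_c) ≤ B`
(the forms are sums of squares, `½x ≤ x` for `x ≥ 0`). -/
theorem sum_formM_interface_le {D : ℕ} (ϑ : Fin D → Literature.MathematicalPhysics.QuantumLattice.ZdEdge 4 → ℝ) (s : Fin D → DirFree H → ℝ)
    {B : ℝ} (hE : ∑ c, formM (fun e => e ∉ dirFreeEdges H) dirCorner (2 * H + 3) (ϑ c) (s c) ≤ B) :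
    ∑ c, formM (fun e => e ∉ dirFreeEdges H) dirCorner (2 * H + 3) ((Real.sqrt 2)⁻¹ • ϑ c) ((Real.sqrt 2)⁻¹ • s c) ≤ B := by
  rw [sum_formM_interface_eq]
  have h0 : 0 ≤ ∑ c, formM (fun e => e ∉ dirFreeEdges H) dirCorner (2 * H + 3) (ϑ c) (s c) :=
    Finset.sum_nonneg fun c _ => by unfold formM; positivity
  linarith

/-- **(U0)** the chart relation in interface units: `datVec ϑ e = √2 • datVec ϑI e`. -/
theorem datVec_eq_sqrt_two_smul_datVec_interface {D : ℕ} (ϑ : Fin D → Literature.MathematicalPhysics.QuantumLattice.ZdEdge 4 → ℝ)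
    (e : Literature.MathematicalPhysics.QuantumLattice.ZdEdge 4) :
    datVec ϑ e = Real.sqrt 2 • datVec (fun c => (Real.sqrt 2)⁻¹ • ϑ c) e := by
  rw [datVec_smul_family, smul_smul, mul_inv_cancel₀ (Real.sqrt_ne_zero'.2 (by norm_num : (0:ℝ) < 2)), one_smul]

/-- `‖datVec ϑI e‖ = (√2)⁻¹‖datVec ϑ e‖ ≤ ‖datVec ϑ e‖`. -/
theorem norm_datVec_interface_le {D : ℕ} (ϑ : Fin D → Literature.MathematicalPhysics.QuantumLattice.ZdEdge 4 → ℝ)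
    (e : Literature.MathematicalPhysics.QuantumLattice.ZdEdge 4) :
    ‖datVec (fun c => (Real.sqrt 2)⁻¹ • ϑ c) e‖ ≤ ‖datVec ϑ e‖ := by
  rw [datVec_smul_family, norm_smul, Real.norm_eq_abs, abs_of_nonneg (inv_nonneg.2 (Real.sqrt_nonneg 2))]
  have h1 : (Real.sqrt 2)⁻¹ ≤ 1 := by
    rw [inv_le_one_iff₀]; right
    rw [show (1 : ℝ) = Real.sqrt 1 by rw [Real.sqrt_one]]; exact Real.sqrt_le_sqrt (by norm_num)
  exact (mul_le_of_le_one_left (norm_nonneg _) h1)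

/-- Forest zeros transfer to the interface datum. -/
theorem interface_forest_zero {D : ℕ} (ϑ : Fin D → Literature.MathematicalPhysics.QuantumLattice.ZdEdge 4 → ℝ)
    {x : Site 4} (h : ∀ c, ϑ c (x, 0) = 0) (c : Fin D) : ((Real.sqrt 2)⁻¹ • ϑ c) (x, 0) = 0 := by
  rw [Pi.smul_apply, h c, smul_zero]

end Summit.QuantumFields.YangMills.Theorems.ColdBoxAllGroups

end
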